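import Mathlib.NumberTheory.NumberField.Discriminant.Different
import Mathlib.RingTheory.RamificationInertia.Ramification
import Mathlib.Analysis.Complex.ExponentialBounds
import HarnessLib

/-!
# Ramified primes and ramification indices cost at most `3 · log N(𝔇_{K/ℚ})`

Topic `NumberTheory/NumberFields`.  Theorem-only file (no definition, no named fact).

For a number field `K` with different `𝔇 = 𝔇_{𝓞_K/ℤ}` (`N(𝔇) = |d_K|`, Mathlib
`NumberField.absNorm_differentIdeal`), every maximal ideal `𝔭` of `𝓞_K` with ramification
index `e_𝔭` over `𝔭 ∩ ℤ` satisfies `𝔭^{e_𝔭 - 1} ∣ 𝔇` (Dedekind; Mathlib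
`pow_sub_one_dvd_differentIdeal`).  Summing over distinct primes:

* `prod_pow_ramificationIdx_sub_one_dvd_differentIdeal` — `∏_{𝔭 ∈ T} 𝔭^{e_𝔭-1} ∣ 𝔇`;
* `sum_ramificationIdx_sub_one_mul_log_absNorm_le` — `∑_{𝔭 ∈ T} (e_𝔭 - 1)·log N𝔭 ≤ log N(𝔇)`;
* `sum_log_le_log_absNorm_differentIdeal_of_ramified` — for distinct rational primes `p`, each
  lying under a prime `𝔭` with `e_𝔭 ≥ 2`: `∑ log p ≤ log N(𝔇)`;
* `sum_log_le_of_dvd_ramificationIdx` — for distinct rational primes `q`, each dividing some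
  ramification index `e_𝔭`: `∑ log q ≤ (log 2)⁻¹ · log N(𝔇)`;
* `sum_log_le_three_mul_log_absNorm_differentIdeal` — both kinds together cost
  `≤ 3 · log N(𝔇)` (in fact `≤ (1 + 1/log 2) · log N(𝔇)`), and the `|d_K|`-form
  `sum_log_le_three_mul_log_natAbs_discr`.

This is the estimate "the primes appearing in the arithmetic divisor that gives rise to
log-diff appear with multiplicity `≥` one less than the ramification indices of `L/ℚ`, [so]
`x_{S•} ≤ x_{S°} + 3d · log-diff([E_L])`" in the proof of [GenEll] Corollary 4.3
(`d · log-diff = log N(𝔇_{L/ℚ})` in the normalisation of [GenEll] Definition 1.5 (iii)).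

## References

* S. Mochizuki, *Arithmetic elliptic curves in general position*, Math. J. Okayama Univ. 52
  (2010), proof of Corollary 4.3, p. 23. [MochizukiGenEll2010]
* J.-P. Serre, *Local Fields*, GTM 67 (1979), Ch. III §6, Prop. 13 (`v_𝔓(𝔇) ≥ e_𝔓 - 1`). [SerreLocalFields1979]
-/

noncomputable section

open NumberField Ideal IsDedekindDomain Finset

namespace Literature.NumberTheory.NumberFields

variable (K : Type*) [Field K] [NumberField K]

/-- **`𝔭^{e_𝔭 - 1} ∣ 𝔇_{K/ℚ}`** for a maximal ideal `𝔭` of `𝓞_K`, `e_𝔭` its ramification index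
over `𝔭 ∩ ℤ` (Mathlib `pow_sub_one_dvd_differentIdeal`, with the separability of
`Frac(𝓞_K)/Frac(ℤ)` supplied). [cite: SerreLocalFields1979, Ch. III §6 Prop. 13] -/
theorem pow_ramificationIdx_sub_one_dvd_differentIdeal (𝔭 : Ideal (𝓞 K)) [𝔭.IsMaximal] :
    𝔭 ^ (𝔭.ramificationIdx ℤ - 1) ∣ differentIdeal ℤ (𝓞 K) := by
  classical
  have h𝔭 : 𝔭 ≠ ⊥ := Ideal.IsMaximal.ne_bot_of_isIntegral_int 𝔭
  have hp : 𝔭.under ℤ ≠ ⊥ := under_ne_bot ℤ h𝔭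
  haveI : (𝔭.under ℤ).IsMaximal := IsMaximal.under ℤ 𝔭
  letI : Algebra (FractionRing ℤ) (FractionRing (𝓞 K)) := FractionRing.liftAlgebra _ _
  haveI : Algebra.IsSeparable (FractionRing ℤ) (FractionRing (𝓞 K)) := by
    refine Algebra.IsSeparable.of_equiv_equiv (FractionRing.algEquiv ℤ ℚ).symm.toRingEquiv
      (FractionRing.algEquiv (𝓞 K) K).symm.toRingEquiv ?_
    ext x
    exact IsFractionRing.algEquiv_commutes (FractionRing.algEquiv ℤ ℚ).symm
      (FractionRing.algEquiv (𝓞 K) K).symm _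
  have hPe : 𝔭 ^ 𝔭.ramificationIdx ℤ ∣ (𝔭.under ℤ).map (algebraMap ℤ (𝓞 K)) := by
    rw [← ramificationIdx'_eq_ramificationIdx (𝔭.under ℤ) 𝔭 hp, dvd_iff_le]
    exact le_pow_ramificationIdx'
  exact pow_sub_one_dvd_differentIdeal ℤ 𝔭 _ hp hPe

/-- **`∏_{𝔭 ∈ T} 𝔭^{e_𝔭 - 1} ∣ 𝔇_{K/ℚ}`** for any finite set `T` of maximal ideals of `𝓞_K`
(distinct maximal ideals are pairwise coprime). [cite: SerreLocalFields1979, Ch. III §6 Prop. 13] -/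
theorem prod_pow_ramificationIdx_sub_one_dvd_differentIdeal (T : Finset (Ideal (𝓞 K)))
    (hT : ∀ 𝔭 ∈ T, 𝔭.IsMaximal) :
    (∏ 𝔭 ∈ T, 𝔭 ^ (𝔭.ramificationIdx ℤ - 1)) ∣ differentIdeal ℤ (𝓞 K) := by
  refine Finset.prod_dvd_of_coprime ?_ ?_
  · intro 𝔭 h𝔭 𝔮 h𝔮 hne
    exact (Ideal.isCoprime_iff_sup_eq.mpr ((hT 𝔭 h𝔭).coprime_of_ne (hT 𝔮 h𝔮) hne)).pow
  · intro 𝔭 h𝔭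
    haveI := hT 𝔭 h𝔭
    exact pow_ramificationIdx_sub_one_dvd_differentIdeal K 𝔭

/-- The norm of the different is positive. [folklore] -/
private theorem absNorm_differentIdeal_pos : 0 < absNorm (differentIdeal ℤ (𝓞 K)) :=
  Nat.pos_of_ne_zero (mt absNorm_eq_zero_iff.mp
    (differentIdeal_ne_bot : differentIdeal ℤ (𝓞 K) ≠ ⊥))

/-- **`∑_{𝔭 ∈ T} (e_𝔭 - 1) · log N(𝔭) ≤ log N(𝔇_{K/ℚ})`** for any finite set `T` of maximal
ideals of `𝓞_K`: take norms and logarithms in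
`prod_pow_ramificationIdx_sub_one_dvd_differentIdeal`.
[cite: MochizukiGenEll2010, proof of Cor. 4.3, p. 23] -/
theorem sum_ramificationIdx_sub_one_mul_log_absNorm_le (T : Finset (Ideal (𝓞 K)))
    (hT : ∀ 𝔭 ∈ T, 𝔭.IsMaximal) :
    ∑ 𝔭 ∈ T, ((𝔭.ramificationIdx ℤ : ℝ) - 1) * Real.log (absNorm 𝔭) ≤
      Real.log (absNorm (differentIdeal ℤ (𝓞 K))) := by
  have hdvd := map_dvd Ideal.absNorm (prod_pow_ramificationIdx_sub_one_dvd_differentIdeal K T hT)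
  rw [map_prod] at hdvd
  simp only [map_pow] at hdvd
  have hpos := absNorm_differentIdeal_pos K
  have hle : (∏ 𝔭 ∈ T, absNorm 𝔭 ^ (𝔭.ramificationIdx ℤ - 1) : ℕ) ≤
      absNorm (differentIdeal ℤ (𝓞 K)) := Nat.le_of_dvd hpos hdvd
  have hN : ∀ 𝔭 ∈ T, 0 < (absNorm 𝔭 : ℝ) := by
    intro 𝔭 h𝔭
    haveI := hT 𝔭 h𝔭
    exact_mod_cast Nat.pos_of_ne_zero
      (mt absNorm_eq_zero_iff.mp (Ideal.IsMaximal.ne_bot_of_isIntegral_int 𝔭))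
  have he : ∀ 𝔭 ∈ T, 1 ≤ 𝔭.ramificationIdx ℤ := by
    intro 𝔭 h𝔭
    haveI := hT 𝔭 h𝔭
    exact Ideal.ramificationIdx_pos 𝔭 ℤ
  calc ∑ 𝔭 ∈ T, ((𝔭.ramificationIdx ℤ : ℝ) - 1) * Real.log (absNorm 𝔭)
      = Real.log (∏ 𝔭 ∈ T, (absNorm 𝔭 : ℝ) ^ (𝔭.ramificationIdx ℤ - 1)) := by
        rw [Real.log_prod]
        · refine Finset.sum_congr rfl fun 𝔭 h𝔭 => ?_
          rw [Real.log_pow, Nat.cast_sub (he 𝔭 h𝔭), Nat.cast_one]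
        · intro 𝔭 h𝔭
          exact pow_ne_zero _ (hN 𝔭 h𝔭).ne'
    _ ≤ Real.log (absNorm (differentIdeal ℤ (𝓞 K))) := by
        refine Real.log_le_log ?_ ?_
        · exact Finset.prod_pos fun 𝔭 h𝔭 => pow_pos (hN 𝔭 h𝔭) _
        · exact_mod_cast hle

omit [NumberField K] in
/-- If a rational prime `p` lies in a maximal ideal `𝔭` of `𝓞_K`, then `𝔭 ∩ ℤ = (p)`. [folklore] -/
private theorem under_eq_span_of_mem {p : ℕ} (hp : p.Prime) (𝔭 : Ideal (𝓞 K)) [𝔭.IsMaximal]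
    (hmem : (p : 𝓞 K) ∈ 𝔭) : 𝔭.under ℤ = Ideal.span {(p : ℤ)} := by
  have hmax : (Ideal.span {(p : ℤ)}).IsMaximal :=
    Ideal.IsPrime.isMaximal (Ideal.span_singleton_prime (by exact_mod_cast hp.ne_zero) |>.mpr
      (Nat.prime_iff_prime_int.mp hp)) (by simpa using hp.ne_zero)
  refine (hmax.eq_of_le (IsPrime.under ℤ 𝔭).ne_top ?_).symm
  rw [Ideal.span_singleton_le_iff_mem, Ideal.under_def, Ideal.mem_comap, map_natCast]
  exact hmem

/-- If a rational prime `p` lies in a maximal ideal `𝔭` of `𝓞_K`, then `p ∣ N(𝔭)`. [folklore] -/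
private theorem dvd_absNorm_of_mem {p : ℕ} (hp : p.Prime) (𝔭 : Ideal (𝓞 K)) [𝔭.IsMaximal]
    (hmem : (p : 𝓞 K) ∈ 𝔭) : p ∣ absNorm 𝔭 := by
  have h2 : (absNorm 𝔭 : ℤ) ∈ 𝔭.under ℤ := by
    rw [Ideal.under_def, Ideal.mem_comap, map_natCast]
    exact Ideal.absNorm_mem 𝔭
  rw [under_eq_span_of_mem K hp 𝔭 hmem, Ideal.mem_span_singleton] at h2
  exact_mod_cast h2

/-- **Ramified rational primes cost at most `log N(𝔇)`**: if `A` is a finite set of rational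
primes and every `p ∈ A` lies under a maximal ideal `𝔭` of `𝓞_K` of ramification index
`e_𝔭 ≥ 2`, then `∑_{p ∈ A} log p ≤ log N(𝔇_{K/ℚ})` (each such `p` contributes
`log p ≤ (e_𝔭 - 1) log N𝔭`, and distinct `p` have distinct `𝔭`).
[cite: MochizukiGenEll2010, proof of Cor. 4.3, p. 23] -/
theorem sum_log_le_log_absNorm_differentIdeal_of_ramified (A : Finset ℕ)
    (hA : ∀ p ∈ A, p.Prime ∧ ∃ 𝔭 : Ideal (𝓞 K), 𝔭.IsMaximal ∧ (p : 𝓞 K) ∈ 𝔭 ∧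
      2 ≤ 𝔭.ramificationIdx ℤ) :
    ∑ p ∈ A, Real.log p ≤ Real.log (absNorm (differentIdeal ℤ (𝓞 K))) := by
  classical
  -- choose a witness prime ideal for each `p ∈ A`
  have hch : ∀ p : ℕ, ∃ 𝔭 : Ideal (𝓞 K), p ∈ A → 𝔭.IsMaximal ∧ (p : 𝓞 K) ∈ 𝔭 ∧
      2 ≤ 𝔭.ramificationIdx ℤ := by
    intro p
    by_cases hp : p ∈ A
    · obtain ⟨-, 𝔭, h𝔭⟩ := hA p hp
      exact ⟨𝔭, fun _ => h𝔭⟩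
    · exact ⟨⊤, fun h => absurd h hp⟩
  choose P hP using hch
  have hinj : Set.InjOn P A := by
    intro p hp q hq hpq
    have h1 := (hP p hp).1
    have h2 := (hP q hq).1
    have hu1 := under_eq_span_of_mem K (hA p hp).1 (P p) (hP p hp).2.1
    have hu2 := under_eq_span_of_mem K (hA q hq).1 (P q) (hP q hq).2.1
    rw [hpq, hu2] at hu1
    have := (Ideal.span_singleton_eq_span_singleton.mp hu1)
    rcases Int.associated_iff_natAbs.mp this |> fun h => h with h
    simpa using h.symm
  calc ∑ p ∈ A, Real.log p
      ≤ ∑ p ∈ A, (((P p).ramificationIdx ℤ : ℝ) - 1) * Real.log (absNorm (P p)) := by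
        refine Finset.sum_le_sum fun p hp => ?_
        haveI := (hP p hp).1
        have hprime := (hA p hp).1
        have hN : (p : ℝ) ≤ absNorm (P p) := by
          have hd := dvd_absNorm_of_mem K hprime (P p) (hP p hp).2.1
          have hne : absNorm (P p) ≠ 0 :=
            mt absNorm_eq_zero_iff.mp (Ideal.IsMaximal.ne_bot_of_isIntegral_int (P p))
          exact_mod_cast Nat.le_of_dvd (Nat.pos_of_ne_zero hne) hd
        have hp0 : (0 : ℝ) < p := by exact_mod_cast hprime.pos
        have hlogp : 0 ≤ Real.log p := Real.log_nonneg (by exact_mod_cast hprime.one_lt.le)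
        have he : (1 : ℝ) ≤ ((P p).ramificationIdx ℤ : ℝ) - 1 := by
          have := (hP p hp).2.2
          have h' : (2 : ℝ) ≤ ((P p).ramificationIdx ℤ : ℝ) := by exact_mod_cast this
          linarith
        calc Real.log p = 1 * Real.log p := (one_mul _).symm
          _ ≤ (((P p).ramificationIdx ℤ : ℝ) - 1) * Real.log (absNorm (P p)) :=
            mul_le_mul he (Real.log_le_log hp0 hN) hlogp (by linarith)
    _ = ∑ 𝔭 ∈ A.image P, ((𝔭.ramificationIdx ℤ : ℝ) - 1) * Real.log (absNorm 𝔭) := by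
        rw [Finset.sum_image hinj]
    _ ≤ Real.log (absNorm (differentIdeal ℤ (𝓞 K))) := by
        refine sum_ramificationIdx_sub_one_mul_log_absNorm_le K _ ?_
        intro 𝔭 h𝔭
        obtain ⟨p, hp, rfl⟩ := Finset.mem_image.mp h𝔭
        exact (hP p hp).1

/-- **Primes dividing ramification indices cost at most `(log 2)⁻¹ · log N(𝔇)`**: if `A` is a
finite set of rational primes and every `q ∈ A` divides the ramification index `e_𝔭` of some
maximal ideal `𝔭` of `𝓞_K`, then `∑_{q ∈ A} log q ≤ (log 2)⁻¹ · log N(𝔇_{K/ℚ})` (the `q` with a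
common witness `𝔭` have product `∣ e_𝔭`, and `log e_𝔭 ≤ e_𝔭 - 1 ≤ (e_𝔭 - 1) log N𝔭 / log 2`).
[cite: MochizukiGenEll2010, proof of Cor. 4.3, p. 23] -/
theorem sum_log_le_of_dvd_ramificationIdx (A : Finset ℕ)
    (hA : ∀ q ∈ A, q.Prime ∧ ∃ 𝔭 : Ideal (𝓞 K), 𝔭.IsMaximal ∧ q ∣ 𝔭.ramificationIdx ℤ) :
    ∑ q ∈ A, Real.log q ≤ (Real.log 2)⁻¹ * Real.log (absNorm (differentIdeal ℤ (𝓞 K))) := by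
  classical
  have hch : ∀ q : ℕ, ∃ 𝔭 : Ideal (𝓞 K), q ∈ A → 𝔭.IsMaximal ∧ q ∣ 𝔭.ramificationIdx ℤ := by
    intro q
    by_cases hq : q ∈ A
    · obtain ⟨-, 𝔭, h𝔭⟩ := hA q hq
      exact ⟨𝔭, fun _ => h𝔭⟩
    · exact ⟨⊤, fun h => absurd h hq⟩
  choose P hP using hch
  have hlog2 : 0 < Real.log 2 := Real.log_pos (by norm_num)
  -- group the sum by the witness `𝔭`
  set T := A.image P with hT
  have hTmax : ∀ 𝔭 ∈ T, 𝔭.IsMaximal := by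
    intro 𝔭 h𝔭
    obtain ⟨q, hq, rfl⟩ := Finset.mem_image.mp h𝔭
    exact (hP q hq).1
  have hfib : ∀ 𝔭 ∈ T, ∑ q ∈ A.filter (fun q => P q = 𝔭), Real.log q ≤
      ((𝔭.ramificationIdx ℤ : ℝ) - 1) := by
    intro 𝔭 h𝔭
    haveI := hTmax 𝔭 h𝔭
    have he : 0 < 𝔭.ramificationIdx ℤ := Ideal.ramificationIdx_pos 𝔭 ℤ
    have hprod : (∏ q ∈ A.filter (fun q => P q = 𝔭), q) ∣ 𝔭.ramificationIdx ℤ := by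
      refine Finset.prod_primes_dvd _ ?_ ?_
      · intro q hq
        exact Nat.prime_iff.mp (hA q (Finset.mem_filter.mp hq).1).1
      · intro q hq
        obtain ⟨hqA, hqP⟩ := Finset.mem_filter.mp hq
        rw [← hqP]
        exact (hP q hqA).2
    have hle : (∏ q ∈ A.filter (fun q => P q = 𝔭), (q : ℝ)) ≤ 𝔭.ramificationIdx ℤ := by
      have h' : ((∏ q ∈ A.filter (fun q => P q = 𝔭), q : ℕ) : ℝ) ≤ (𝔭.ramificationIdx ℤ : ℝ) :=
        Nat.cast_le.mpr (Nat.le_of_dvd he hprod)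
      simpa [Nat.cast_prod] using h'
    have hpos : ∀ q ∈ A.filter (fun q => P q = 𝔭), (0 : ℝ) < q := by
      intro q hq
      exact_mod_cast (hA q (Finset.mem_filter.mp hq).1).1.pos
    calc ∑ q ∈ A.filter (fun q => P q = 𝔭), Real.log q
        = Real.log (∏ q ∈ A.filter (fun q => P q = 𝔭), (q : ℝ)) := by
          rw [Real.log_prod]
          intro q hq
          exact (hpos q hq).ne'
      _ ≤ Real.log (𝔭.ramificationIdx ℤ) := by
          exact Real.log_le_log (Finset.prod_pos hpos) hle
      _ ≤ (𝔭.ramificationIdx ℤ : ℝ) - 1 := Real.log_le_sub_one_of_pos (by exact_mod_cast he)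
  have hN : ∀ 𝔭 ∈ T, Real.log 2 ≤ Real.log (absNorm 𝔭) := by
    intro 𝔭 h𝔭
    haveI := hTmax 𝔭 h𝔭
    refine Real.log_le_log (by norm_num) ?_
    have h1 : absNorm 𝔭 ≠ 0 :=
      mt absNorm_eq_zero_iff.mp (Ideal.IsMaximal.ne_bot_of_isIntegral_int 𝔭)
    have h2 : absNorm 𝔭 ≠ 1 := by
      rw [Ne, Ideal.absNorm_eq_one_iff]
      exact Ideal.IsMaximal.ne_top ‹_›
    have : 2 ≤ absNorm 𝔭 := by omega
    exact_mod_cast this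
  calc ∑ q ∈ A, Real.log q
      = ∑ 𝔭 ∈ T, ∑ q ∈ A.filter (fun q => P q = 𝔭), Real.log q := by
        rw [hT, Finset.sum_fiberwise_of_maps_to]
        intro q hq
        exact Finset.mem_image_of_mem P hq
    _ ≤ ∑ 𝔭 ∈ T, ((𝔭.ramificationIdx ℤ : ℝ) - 1) := Finset.sum_le_sum hfib
    _ ≤ ∑ 𝔭 ∈ T, (Real.log 2)⁻¹ * (((𝔭.ramificationIdx ℤ : ℝ) - 1) *
          Real.log (absNorm 𝔭)) := by
        refine Finset.sum_le_sum fun 𝔭 h𝔭 => ?_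
        haveI := hTmax 𝔭 h𝔭
        have he : (0 : ℝ) ≤ (𝔭.ramificationIdx ℤ : ℝ) - 1 := by
          have := Ideal.ramificationIdx_pos 𝔭 ℤ
          have h' : (1 : ℝ) ≤ 𝔭.ramificationIdx ℤ := by exact_mod_cast this
          linarith
        rw [← mul_assoc, mul_comm ((Real.log 2)⁻¹), mul_assoc]
        calc ((𝔭.ramificationIdx ℤ : ℝ) - 1) = ((𝔭.ramificationIdx ℤ : ℝ) - 1) * 1 :=
              (mul_one _).symm
          _ ≤ ((𝔭.ramificationIdx ℤ : ℝ) - 1) * ((Real.log 2)⁻¹ * Real.log (absNorm 𝔭)) := by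
              refine mul_le_mul_of_nonneg_left ?_ he
              rw [le_inv_mul_iff₀ hlog2, mul_one]
              exact hN 𝔭 h𝔭
    _ = (Real.log 2)⁻¹ * ∑ 𝔭 ∈ T, ((𝔭.ramificationIdx ℤ : ℝ) - 1) *
          Real.log (absNorm 𝔭) := by rw [Finset.mul_sum]
    _ ≤ (Real.log 2)⁻¹ * Real.log (absNorm (differentIdeal ℤ (𝓞 K))) :=
        mul_le_mul_of_nonneg_left (sum_ramificationIdx_sub_one_mul_log_absNorm_le K T hTmax)
          (inv_nonneg.mpr hlog2.le)

/-- **Ramified primes and ramification indices together cost at most `3 · log N(𝔇)`**: if every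
`p` in a finite set `A` of rational primes either lies under a maximal ideal of `𝓞_K` of
ramification index `≥ 2`, or divides the ramification index of some maximal ideal of `𝓞_K`,
then `∑_{p ∈ A} log p ≤ 3 · log N(𝔇_{K/ℚ})` (indeed `≤ (1 + 1/log 2) · log N(𝔇)`).  This is the
bound `x_{S•} - x_{S°} ≤ 3d · log-diff([E_L])` of the proof of [GenEll] Cor. 4.3.
[cite: MochizukiGenEll2010, proof of Cor. 4.3, p. 23] -/
theorem sum_log_le_three_mul_log_absNorm_differentIdeal (A : Finset ℕ)
    (hA : ∀ p ∈ A, p.Prime ∧ ∃ 𝔭 : Ideal (𝓞 K), 𝔭.IsMaximal ∧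
      (((p : 𝓞 K) ∈ 𝔭 ∧ 2 ≤ 𝔭.ramificationIdx ℤ) ∨ p ∣ 𝔭.ramificationIdx ℤ)) :
    ∑ p ∈ A, Real.log p ≤ 3 * Real.log (absNorm (differentIdeal ℤ (𝓞 K))) := by
  classical
  set A₁ := A.filter (fun p : ℕ => ∃ 𝔭 : Ideal (𝓞 K), 𝔭.IsMaximal ∧ (p : 𝓞 K) ∈ 𝔭 ∧
    2 ≤ 𝔭.ramificationIdx ℤ) with hA₁
  set A₂ := A.filter (fun p : ℕ => ¬ ∃ 𝔭 : Ideal (𝓞 K), 𝔭.IsMaximal ∧ (p : 𝓞 K) ∈ 𝔭 ∧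
    2 ≤ 𝔭.ramificationIdx ℤ) with hA₂
  have hsplit : ∑ p ∈ A, Real.log p = ∑ p ∈ A₁, Real.log p + ∑ p ∈ A₂, Real.log p :=
    (Finset.sum_filter_add_sum_filter_not A (fun p : ℕ => ∃ 𝔭 : Ideal (𝓞 K), 𝔭.IsMaximal ∧
      (p : 𝓞 K) ∈ 𝔭 ∧ 2 ≤ 𝔭.ramificationIdx ℤ) (fun p : ℕ => Real.log p)).symm
  have h1 : ∑ p ∈ A₁, Real.log p ≤ Real.log (absNorm (differentIdeal ℤ (𝓞 K))) := by
    refine sum_log_le_log_absNorm_differentIdeal_of_ramified K A₁ ?_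
    intro p hp
    obtain ⟨hpA, h𝔭⟩ := Finset.mem_filter.mp hp
    exact ⟨(hA p hpA).1, h𝔭⟩
  have h2 : ∑ p ∈ A₂, Real.log p ≤
      (Real.log 2)⁻¹ * Real.log (absNorm (differentIdeal ℤ (𝓞 K))) := by
    refine sum_log_le_of_dvd_ramificationIdx K A₂ ?_
    intro p hp
    obtain ⟨hpA, hnot⟩ := Finset.mem_filter.mp hp
    obtain ⟨hprime, 𝔭, h𝔭, h⟩ := hA p hpA
    rcases h with h | h
    · exact absurd ⟨𝔭, h𝔭, h⟩ hnot
    · exact ⟨hprime, 𝔭, h𝔭, h⟩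
  have hlogD : 0 ≤ Real.log (absNorm (differentIdeal ℤ (𝓞 K))) :=
    Real.log_nonneg (by exact_mod_cast absNorm_differentIdeal_pos K)
  have hinv : (Real.log 2)⁻¹ ≤ 2 := by
    have := Real.log_two_gt_d9
    rw [inv_le_comm₀ (by linarith) (by norm_num)]
    linarith
  calc ∑ p ∈ A, Real.log p = ∑ p ∈ A₁, Real.log p + ∑ p ∈ A₂, Real.log p := hsplit
    _ ≤ Real.log (absNorm (differentIdeal ℤ (𝓞 K))) +
        (Real.log 2)⁻¹ * Real.log (absNorm (differentIdeal ℤ (𝓞 K))) := add_le_add h1 h2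
    _ ≤ 3 * Real.log (absNorm (differentIdeal ℤ (𝓞 K))) := by nlinarith

/-- The same bound in terms of the discriminant: `∑_{p ∈ A} log p ≤ 3 · log |d_K|`
(`N(𝔇_{K/ℚ}) = |d_K|`, Mathlib `NumberField.absNorm_differentIdeal`).
[cite: MochizukiGenEll2010, proof of Cor. 4.3, p. 23] -/
theorem sum_log_le_three_mul_log_natAbs_discr (A : Finset ℕ)
    (hA : ∀ p ∈ A, p.Prime ∧ ∃ 𝔭 : Ideal (𝓞 K), 𝔭.IsMaximal ∧
      (((p : 𝓞 K) ∈ 𝔭 ∧ 2 ≤ 𝔭.ramificationIdx ℤ) ∨ p ∣ 𝔭.ramificationIdx ℤ)) :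
    ∑ p ∈ A, Real.log p ≤ 3 * Real.log ((discr K).natAbs : ℝ) := by
  have h := sum_log_le_three_mul_log_absNorm_differentIdeal K A hA
  rwa [absNorm_differentIdeal K (𝓞 K)] at h

/-- **Radical bound for the discriminant** — the `p ∣ d_K` form of "the primes of `ℚ` that
ramify in `L`" in the same estimate: distinct rational primes dividing `d_K` have
`∑ log p ≤ log |d_K|`. [cite: MochizukiGenEll2010, proof of Cor. 4.3, p. 23] -/
theorem sum_log_le_log_natAbs_discr_of_dvd (A : Finset ℕ)
    (hA : ∀ p ∈ A, p.Prime ∧ (p : ℤ) ∣ discr K) :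
    ∑ p ∈ A, Real.log p ≤ Real.log ((discr K).natAbs : ℝ) := by
  have hD : (discr K).natAbs ≠ 0 := Int.natAbs_ne_zero.mpr (discr_ne_zero K)
  have hprod : (∏ p ∈ A, p) ∣ (discr K).natAbs := by
    refine Finset.prod_primes_dvd _ (fun p hp => Nat.prime_iff.mp (hA p hp).1) ?_
    intro p hp
    exact Int.natCast_dvd.mp (by simpa using (Int.dvd_natAbs.mpr (hA p hp).2))
  have hpos : ∀ p ∈ A, (0 : ℝ) < p := fun p hp => by exact_mod_cast (hA p hp).1.pos
  have hle : (∏ p ∈ A, (p : ℝ)) ≤ ((discr K).natAbs : ℝ) := by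
    have h' : ((∏ p ∈ A, p : ℕ) : ℝ) ≤ ((discr K).natAbs : ℝ) :=
      Nat.cast_le.mpr (Nat.le_of_dvd (Nat.pos_of_ne_zero hD) hprod)
    simpa [Nat.cast_prod] using h'
  calc ∑ p ∈ A, Real.log p = Real.log (∏ p ∈ A, (p : ℝ)) := by
        rw [Real.log_prod]
        exact fun p hp => (hpos p hp).ne'
    _ ≤ Real.log ((discr K).natAbs : ℝ) := Real.log_le_log (Finset.prod_pos hpos) hle

end Literature.NumberTheory.NumberFields
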